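import Summits.HodgeConjecture.CorCM.GaloisCertificateSplitExtension
import HarnessLib

/-!
# BAD is monotone along split extensions with kernel of ORDER TWO (`G = Q × C₂`), as soon as `Q` is not of exponent two:
# the lift of a certificate through a right translate that is no involutive left translate

COR-CM (cell `pub-hodgecm2`), binder seat b04 (gen 31), count-neutral own lane «Galois-CM-type classification»; sequel of
`CorCM/GaloisCertificateSplitExtension` (`|ker| ≥ 3`), treating the remaining case `|ker f| = 2`, i.e. `G ≅ Q × C₂`.  KERNEL ONLY:
theorems; no definition, no named fact, no `sorry`.  `HC_CM` is neither used nor claimed.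

For `|ker f| = 2` the lift of gens 30/31 (flip ONE coset of the complement to the complementary set) is stabilised by `σ(c₀) n₁`;
gen 30's `CorCM/GaloisCertificateTimesTwo` therefore asked for a right translate `T₀ w` that is NO left translate `a T₀` — a
hypothesis that no abelian `Γ₀` satisfies.  THIS FILE shows that the right hypothesis (`T₀ w ≠ a T₀` for the INVOLUTIONS `a`
only) is AUTOMATIC:

§1 (**`exists_forall_involution_translate_ne`**, pure group theory).  `T₀ ⊂ Q` with trivial left stabiliser and `Q` NOT of
exponent `2` ⟹ there is `w ∈ Q` with `T₀ w ≠ a T₀` for EVERY `a` with `a² = 1`.  Proof: otherwise `T₀ w = a_w T₀` with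
`a_w² = 1` for all `w`; the relation `T₀ w = a⁻¹ T₀` is stable under products and inverses (`translate_rel_mul`, `translate_rel_inv`),
so `T₀ w² = T₀` for every `w`, and the right stabiliser `R = {r : T₀ r = T₀}` is normalised by every `g` (`T₀ · g r g⁻¹ =
a_g a_g⁻¹ T₀ = T₀`); a NORMAL right stabiliser lies in the left stabiliser (`r t = t · t⁻¹ r t ∈ T₀ R = T₀`), which is trivial
— so every square is `1`, a contradiction.
§2 (the lift, `f : G →* Q`, `σ : Q →* G`, `f ∘ σ = id`, `ker f = {1, n₁}`; then `n₁` is a central involution, `kerTwo_comm`,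
`kerTwo_mul_self`).  `S = σ(T₀) ⊔ σ(T₀ w) n₁` and `b = b₀ ∘ f` on `σ(Q)`: CM for `σ(c₀)` (`mem_liftTwo_cm`), annihilated
(`liftTwo_annihilated`: `S g ∩ σ(Q)` is `σ(T₀ · f g)` or `σ(T₀ w · f g)`), and with trivial left stabiliser
(`liftTwo_leftStabiliser`): a period `σ(a)` forces `a T₀ = T₀`; a period `σ(a) n₁` forces `T₀ w = a⁻¹ T₀` and `T₀ = a⁻¹ T₀ w`,
hence `a² = 1` (excluded by the choice of `w`) or `a² T₀ = T₀` with `a² ≠ 1` (excluded by primitivity).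
**`exists_liftTwo_certificate`**: `f ∘ σ = id`, `ker f = {1, n₁}`, `Q` not of exponent `2`, certificate for `(Q, c₀)` ⟹ certificate
for `(G, σ c₀)`.
§3 (Galois CM fields, model form).  **`exists_simple_degenerate_of_split_two_certificate`**; **`exists_simple_degenerate_prod_of_
certificate_of_sq_ne_one`**: `Gal(K/ℚ) ≃* Γ₀ × H` with `|H| = 2`, complex conjugation `(c₀, 1)`, `Γ₀` not of exponent `2`, an
annihilator certificate for `(Γ₀, c₀)` ⟹ `K` carries a SIMPLE DEGENERATE abelian variety of dimension `|Γ₀|` with CM by `K`.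
With `CorCM/GaloisCertificateSplitExtension` (`|H| ≥ 3`): **`Γ₀ × H` is BAD for every certified-BAD `Γ₀` and every finite group
`H ≠ 1`, except possibly `|H| = 2 ∧ Γ₀ ≅ C₂ᵏ`** (there `Γ₀` BAD forces `k ≥ 5` and `Γ₀ × C₂ = C₂ᵏ⁺¹` is BAD anyway by the
abelian classification, `CorCM/AbelianTwoPowerClassification`).  Consequences for the classification table: `D_{2^k}(2^{k+1}) ×
C₂`, `SD_{2^{k+1}} × C₂`, `M_{2^{k+1}} × C₂` are BAD for every `k ≥ 4` (base groups BAD by gens 22–23, with elements of order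
`4`) — the last open `× C₂` rows.  The GOOD `Q₈ × C₂`, `Q₁₆ × C₂`, `D₄ × C₂`-fields are consistent (GOOD quotients).  The field
form (`K = K₀(√d)`) is `CorCM/GaloisDegenerateRealQuadraticFactor`.  Seat numerics `scratch/times_two.py` (`SD₁₆`, `M₁₆`,
`ℤ/8 × ℤ/2` (`c ∉ ℤ/8`), `D₁₀` times `C₂`: ranks `9, 9, 14, 18 <` `17, 17, 17, 21`).

## References

* [Kubota1965] T. Kubota, *On the field extension by complex multiplication*, Trans. AMS 118 (1965), §2, §4 Lemma 2.
* [Shimura1998] G. Shimura, *Abelian Varieties with Complex Multiplication and Modular Functions*, §6.2 Thm. 3, §8.2 Prop. 26,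
  §18.2 Lemma (i).
* [Gordon1999HodgeAVSurvey] B. B. Gordon, *A survey of the Hodge conjecture for abelian varieties*, Thm. 6.4, §9.3.
-/

noncomputable section

open CategoryTheory CategoryTheory.Limits NumberField
open scoped BigOperators

namespace Summit.HodgeConjecture.CorCM.GaloisModels

open Literature.NumberTheory.ComplexMultiplication
open Literature.AlgebraicGeometry.Motives (AbelianVariety CMType)
open Literature.AlgebraicGeometry.HodgeTheory
open Literature.AlgebraicGeometry.ComplexMultiplication (IsCMTypeRealisation)
open Literature.AlgebraicGeometry.Pohlmann1968
open Literature.Barriers.HodgeConjecture (divisorClassesSpan)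
open Summit.HodgeConjecture.CorCM.GaloisRank

namespace SplitExtension

/-! ## §1 A right translate that is no involutive left translate -/

section Translate

variable {Q : Type*} [Group Q] (T₀ : Finset Q)

/-- The relation `T₀ w = a⁻¹ T₀` (`q w⁻¹ ∈ T₀ ↔ a q ∈ T₀`) is multiplicative: with `T₀ w' = a'⁻¹ T₀` one gets
`T₀ w w' = (a' a)⁻¹ T₀`. [folklore] -/
theorem translate_rel_mul {w w' a a' : Q} (h : ∀ q, q * w⁻¹ ∈ T₀ ↔ a * q ∈ T₀) (h' : ∀ q, q * w'⁻¹ ∈ T₀ ↔ a' * q ∈ T₀)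
    (q : Q) : q * (w * w')⁻¹ ∈ T₀ ↔ a' * a * q ∈ T₀ := by
  rw [mul_inv_rev, ← mul_assoc, h (q * w'⁻¹), ← mul_assoc, h' (a * q), mul_assoc]

/-- … and stable under inverses: `T₀ w⁻¹ = a T₀`. [folklore] -/
theorem translate_rel_inv {w a : Q} (h : ∀ q, q * w⁻¹ ∈ T₀ ↔ a * q ∈ T₀) (q : Q) : q * w⁻¹⁻¹ ∈ T₀ ↔ a⁻¹ * q ∈ T₀ := by
  rw [inv_inv]
  have := h (a⁻¹ * q * w)
  rw [mul_inv_cancel_right, mul_assoc, mul_inv_cancel_left] at this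
  exact this.symm

/-- **A set with trivial left stabiliser in a group NOT of exponent two has a right translate `T₀ w` which is no left translate
`a T₀` with `a² = 1`.**  (Otherwise every square lies in the right stabiliser, which is then normal, hence inside the — trivial —
left stabiliser.) [folklore] -/
theorem exists_forall_involution_translate_ne (hprim : ∀ v : Q, v ≠ 1 → ∃ q : Q, ¬ (q ∈ T₀ ↔ v * q ∈ T₀))
    (hexp : ∃ g : Q, g * g ≠ 1) :
    ∃ w : Q, ∀ a : Q, a * a = 1 → ∃ q : Q, ¬ (q * w⁻¹ ∈ T₀ ↔ a * q ∈ T₀) := by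
  by_contra H
  have E : ∀ w : Q, ∃ a : Q, a * a = 1 ∧ ∀ q, (q * w⁻¹ ∈ T₀ ↔ a * q ∈ T₀) := by
    intro w
    by_contra h
    refine H ⟨w, fun a ha => ?_⟩
    by_contra h'
    refine h ⟨a, ha, fun q => ?_⟩
    by_contra h''
    exact h' ⟨q, h''⟩
  choose α hα1 hα using E
  -- an element of the right stabiliser (`T₀ r = T₀`) is trivial: the right stabiliser is normal, hence a left stabiliser
  have stab : ∀ r : Q, (∀ q, (q * r⁻¹ ∈ T₀ ↔ 1 * q ∈ T₀)) → r = 1 := by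
    intro r hr
    have hnorm : ∀ g q : Q, (q * (g * r * g⁻¹)⁻¹ ∈ T₀ ↔ 1 * q ∈ T₀) := by
      intro g q
      have h1 := translate_rel_mul T₀ (hα g) hr
      have h2 := translate_rel_mul T₀ h1 (translate_rel_inv T₀ (hα g))
      rw [h2 q, one_mul, inv_mul_cancel]
    by_contra hr1
    obtain ⟨q, hq⟩ := hprim r hr1
    apply hq
    have := hnorm q⁻¹ (r * q)
    rw [inv_inv, show r * q * (q⁻¹ * r * q)⁻¹ = q by group, one_mul] at this
    exact this
  obtain ⟨g, hg⟩ := hexp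
  refine hg (stab (g * g) fun q => ?_)
  rw [translate_rel_mul T₀ (hα g) (hα g) q, hα1 g]

end Translate

/-! ## §2 The lift along a split extension with kernel of order two -/

section ModelTwo

variable {G Q : Type*} [Group G] [Group Q] {f : G →* Q} {σ : Q →* G}

omit [Group Q] in
/-- A group of order two is `{1, h₁}` with `h₁ ≠ 1`. [folklore] -/
theorem exists_ne_one_of_card_eq_two {H : Type*} [Group H] (hH : Nat.card H = 2) :
    ∃ h₁ : H, h₁ ≠ 1 ∧ ∀ h : H, h = 1 ∨ h = h₁ := by
  obtain ⟨a, b, hab, huniv⟩ := Nat.card_eq_two_iff.1 hH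
  have hmem : ∀ g : H, g = a ∨ g = b := fun g => by
    have : g ∈ ({a, b} : Set H) := by rw [huniv]; exact Set.mem_univ g
    simpa using this
  by_cases ha : a = 1
  · refine ⟨b, fun h => hab (ha.trans h.symm), fun g => ?_⟩
    rcases hmem g with h | h
    · exact Or.inl (h.trans ha)
    · exact Or.inr h
  · refine ⟨a, ha, fun g => ?_⟩
    have hb : b = 1 := by
      rcases hmem 1 with h | h
      · exact absurd h.symm ha
      · exact h.symm
    rcases hmem g with h | h
    · exact Or.inr h
    · exact Or.inl (h.trans hb)

/-- `ker f = {1, n₁}`: `n₁² = 1`. [folklore] -/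
theorem kerTwo_mul_self {n₁ : G} (hn₁ : f n₁ = 1) (h₁ : n₁ ≠ 1) (hker : ∀ n : G, f n = 1 → n = 1 ∨ n = n₁) :
    n₁ * n₁ = 1 := by
  rcases hker (n₁ * n₁) (by rw [map_mul, hn₁, mul_one]) with h | h
  · exact h
  · exact absurd (mul_left_cancel (h.trans (mul_one n₁).symm)) h₁

/-- `ker f = {1, n₁}`: `n₁` is central. [folklore] -/
theorem kerTwo_comm {n₁ : G} (hn₁ : f n₁ = 1) (h₁ : n₁ ≠ 1) (hker : ∀ n : G, f n = 1 → n = 1 ∨ n = n₁) (g : G) :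
    g * n₁ = n₁ * g := by
  rcases hker (g * n₁ * g⁻¹) (by rw [map_mul, map_mul, hn₁, mul_one, map_inv, mul_inv_cancel]) with h | h
  · exact absurd (by simpa [mul_inv_eq_one, mul_eq_left] using h) h₁
  · calc g * n₁ = g * n₁ * g⁻¹ * g := by group
      _ = n₁ * g := by rw [h]

variable [Fintype G] [DecidableEq G] [DecidableEq Q]

/-- Membership in the lifted set `S = σ(T₀) ⊔ σ(T₀ w) n₁`, written as `{x : ν(x) = 1 → f x ∈ T₀; ν(x) ≠ 1 → f(x) w⁻¹ ∈ T₀}`.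
[folklore] -/
theorem mem_liftTwo_iff (T₀ : Finset Q) (w : Q) (x : G) :
    x ∈ (Finset.univ.filter fun y : G => if (σ (f y))⁻¹ * y = 1 then f y ∈ T₀ else f y * w⁻¹ ∈ T₀) ↔
      (if (σ (f x))⁻¹ * x = 1 then f x ∈ T₀ else f x * w⁻¹ ∈ T₀) := by
  rw [Finset.mem_filter, and_iff_right (Finset.mem_univ x)]

/-- Coordinates on the complement: `σ(q) ∈ S ↔ q ∈ T₀`. [folklore] -/
theorem sigma_mem_liftTwo_iff (hfσ : ∀ q, f (σ q) = q) (T₀ : Finset Q) (w q : Q) :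
    σ q ∈ (Finset.univ.filter fun y : G => if (σ (f y))⁻¹ * y = 1 then f y ∈ T₀ else f y * w⁻¹ ∈ T₀) ↔ q ∈ T₀ := by
  rw [mem_liftTwo_iff, hfσ, if_pos (inv_mul_cancel (σ q))]

/-- Coordinates on the other coset: `σ(q) n₁ ∈ S ↔ q w⁻¹ ∈ T₀`. [folklore] -/
theorem sigma_mul_mem_liftTwo_iff (hfσ : ∀ q, f (σ q) = q) {n₁ : G} (hn₁ : f n₁ = 1) (h₁ : n₁ ≠ 1) (T₀ : Finset Q)
    (w q : Q) :
    σ q * n₁ ∈ (Finset.univ.filter fun y : G => if (σ (f y))⁻¹ * y = 1 then f y ∈ T₀ else f y * w⁻¹ ∈ T₀) ↔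
      q * w⁻¹ ∈ T₀ := by
  rw [mem_liftTwo_iff, kerPart_sigma_mul_of_ker hfσ q hn₁, if_neg h₁, map_sigma_mul hfσ q hn₁]

/-- **The lifted set is a CM set for `σ(c₀)`.** [cite: Shimura1998, §18.2 Lemma (i)] -/
theorem mem_liftTwo_cm (hfσ : ∀ q, f (σ q) = q) (c₀ : Q) (T₀ : Finset Q) (hcm : ∀ q : Q, q ∈ T₀ ↔ c₀ * q ∉ T₀)
    (w : Q) (x : G) :
    x ∈ (Finset.univ.filter fun y : G => if (σ (f y))⁻¹ * y = 1 then f y ∈ T₀ else f y * w⁻¹ ∈ T₀) ↔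
      σ c₀ * x ∉ (Finset.univ.filter fun y : G => if (σ (f y))⁻¹ * y = 1 then f y ∈ T₀ else f y * w⁻¹ ∈ T₀) := by
  rw [mem_liftTwo_iff, mem_liftTwo_iff, kerPart_sigma_mul hfσ, map_mul, hfσ]
  split_ifs with h
  · exact hcm (f x)
  · rw [mul_assoc]; exact hcm (f x * w⁻¹)

/-- **The lifted set has trivial left stabiliser** when `T₀ w` is no left translate `a T₀` with `a² = 1`.
[cite: Shimura1998, §8.2 Prop. 26] -/
theorem liftTwo_leftStabiliser (hfσ : ∀ q, f (σ q) = q) {n₁ : G} (hn₁ : f n₁ = 1) (h₁ : n₁ ≠ 1)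
    (hker : ∀ n : G, f n = 1 → n = 1 ∨ n = n₁) (T₀ : Finset Q)
    (hprim : ∀ v : Q, v ≠ 1 → ∃ q : Q, ¬ (q ∈ T₀ ↔ v * q ∈ T₀)) (w : Q)
    (hw : ∀ a : Q, a * a = 1 → ∃ q : Q, ¬ (q * w⁻¹ ∈ T₀ ↔ a * q ∈ T₀)) (v : G) (hv : v ≠ 1) :
    ∃ g : G, ¬ (g ∈ (Finset.univ.filter fun y : G => if (σ (f y))⁻¹ * y = 1 then f y ∈ T₀ else f y * w⁻¹ ∈ T₀) ↔
      v * g ∈ (Finset.univ.filter fun y : G => if (σ (f y))⁻¹ * y = 1 then f y ∈ T₀ else f y * w⁻¹ ∈ T₀)) := by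
  have hcen := kerTwo_comm hn₁ h₁ hker
  have hinv := kerTwo_mul_self hn₁ h₁ hker
  obtain ⟨a, ha⟩ : ∃ a : Q, f v = a := ⟨_, rfl⟩
  rcases hker ((σ (f v))⁻¹ * v) (map_kerPart hfσ v) with hm | hm
  · -- `v = σ(a)` with `a = f v ≠ 1`
    have hv' : v = σ a := by rw [← ha]; exact (inv_mul_eq_one.1 hm).symm
    subst hv'
    have ha1 : a ≠ 1 := fun h => hv (by rw [h, map_one])
    obtain ⟨q, hq⟩ := hprim a ha1
    refine ⟨σ q, ?_⟩
    rwa [← map_mul, sigma_mem_liftTwo_iff hfσ, sigma_mem_liftTwo_iff hfσ]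
  · -- `v = σ(a) n₁`
    have hv' : v = σ a * n₁ := by rw [← ha, ← hm, mul_inv_cancel_left]
    subst hv'
    by_contra H
    have H' : ∀ g : G, (g ∈ (Finset.univ.filter fun y : G => if (σ (f y))⁻¹ * y = 1 then f y ∈ T₀ else f y * w⁻¹ ∈ T₀) ↔
        σ a * n₁ * g ∈ (Finset.univ.filter fun y : G => if (σ (f y))⁻¹ * y = 1 then f y ∈ T₀ else f y * w⁻¹ ∈ T₀)) := by
      intro g
      by_contra h
      exact H ⟨g, h⟩
    have hvq : ∀ q : Q, σ a * n₁ * σ q = σ (a * q) * n₁ := fun q => by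
      rw [map_mul, mul_assoc, mul_assoc, ← hcen (σ q)]
    have hvq' : ∀ q : Q, σ a * n₁ * (σ q * n₁) = σ (a * q) := fun q => by
      rw [← mul_assoc, hvq, mul_assoc, hinv, mul_one]
    have E1 : ∀ q : Q, (q ∈ T₀ ↔ a * q * w⁻¹ ∈ T₀) := fun q => by
      have := H' (σ q)
      rwa [hvq, sigma_mem_liftTwo_iff hfσ, sigma_mul_mem_liftTwo_iff hfσ hn₁ h₁] at this
    have E2 : ∀ q : Q, (q * w⁻¹ ∈ T₀ ↔ a * q ∈ T₀) := fun q => by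
      have := H' (σ q * n₁)
      rwa [hvq', sigma_mul_mem_liftTwo_iff hfσ hn₁ h₁, sigma_mem_liftTwo_iff hfσ] at this
    by_cases haa : a * a = 1
    · obtain ⟨q, hq⟩ := hw a haa
      exact hq (E2 q)
    · obtain ⟨q, hq⟩ := hprim (a * a) haa
      apply hq
      rw [E1 q, E2 (a * q), mul_assoc]

variable [Fintype Q]

/-- **The lifted weight is annihilated by every right translate of the lifted set**: `S g ∩ σ(Q)` is `σ(T₀ · f g)` or
`σ(T₀ w · f g)` according as `σ(f g) g⁻¹ = 1` or `= n₁`. [cite: Kubota1965, §2] -/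
theorem liftTwo_annihilated (hfσ : ∀ q, f (σ q) = q) (T₀ : Finset Q) (b₀ : Q → ℤ)
    (hann : ∀ g : Q, ∑ s ∈ T₀, b₀ (s * g) = 0) (w : Q) (g : G) :
    ∑ s ∈ (Finset.univ.filter fun y : G => if (σ (f y))⁻¹ * y = 1 then f y ∈ T₀ else f y * w⁻¹ ∈ T₀),
      (if σ (f (s * g)) = s * g then b₀ (f (s * g)) else 0) = 0 := by
  classical
  rw [Finset.sum_ite, Finset.sum_const_zero, add_zero]
  set n : G := σ (f g) * g⁻¹ with hn_def
  have hn : f n = 1 := by rw [hn_def, map_mul, hfσ, map_inv, mul_inv_cancel]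
  have hsg : ∀ q : Q, σ q * n * g = σ (q * f g) := fun q => by
    rw [hn_def, map_mul, mul_assoc, mul_assoc, inv_mul_cancel, mul_one]
  have hset : ((Finset.univ.filter fun y : G => if (σ (f y))⁻¹ * y = 1 then f y ∈ T₀ else f y * w⁻¹ ∈ T₀).filter
      fun s => σ (f (s * g)) = s * g) =
      (Finset.univ.filter fun q : Q => if n = 1 then q ∈ T₀ else q * w⁻¹ ∈ T₀).image fun q => σ q * n := by
    ext s
    simp only [Finset.mem_filter, Finset.mem_univ, true_and, Finset.mem_image]
    constructor
    · rintro ⟨hmem, hfix⟩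
      have hs : s = σ (f s) * n := by
        rw [map_mul, map_mul] at hfix
        rw [hn_def, ← mul_assoc, eq_mul_inv_iff_mul_eq, hfix]
      refine ⟨f s, ?_, hs.symm⟩
      have hν : (σ (f s))⁻¹ * s = n := by
        conv_lhs => rw [hs]
        exact kerPart_sigma_mul_of_ker hfσ (f s) hn
      rwa [hν] at hmem
    · rintro ⟨q, hq, rfl⟩
      refine ⟨?_, ?_⟩
      · rwa [kerPart_sigma_mul_of_ker hfσ q hn, map_sigma_mul hfσ q hn]
      · rw [hsg, hfσ]
  rw [hset, Finset.sum_image (fun q₁ _ q₂ _ h => by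
    have := congrArg f h
    rwa [map_sigma_mul hfσ q₁ hn, map_sigma_mul hfσ q₂ hn] at this)]
  have hsum : ∀ q : Q, b₀ (f (σ q * n * g)) = b₀ (q * f g) := fun q => by rw [hsg, hfσ]
  simp only [hsum]
  by_cases hn₁ : n = 1
  · have hT : (Finset.univ.filter fun q : Q => if n = 1 then q ∈ T₀ else q * w⁻¹ ∈ T₀) = T₀ := by
      ext q; simp [hn₁]
    rw [hT]
    exact hann (f g)
  · -- the translate `T₀ w`
    have hT : (Finset.univ.filter fun q : Q => if n = 1 then q ∈ T₀ else q * w⁻¹ ∈ T₀) = T₀.image fun t => t * w := by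
      ext q
      simp only [Finset.mem_filter, Finset.mem_univ, true_and, hn₁, if_false, Finset.mem_image]
      constructor
      · intro h; exact ⟨q * w⁻¹, h, inv_mul_cancel_right q w⟩
      · rintro ⟨t, ht, rfl⟩; rwa [mul_inv_cancel_right]
    rw [hT, Finset.sum_image (fun t₁ _ t₂ _ h => mul_right_cancel h)]
    simp only [mul_assoc]
    exact hann (w * f g)

/-- **THE LIFT ALONG A SPLIT EXTENSION WITH KERNEL OF ORDER TWO.**  `f ∘ σ = id`, `ker f = {1, n₁}`, `Q` not of exponent `2`,
and an annihilator certificate `(T₀, b₀)` for `(Q, c₀)` ⟹ an annihilator certificate for `(G, σ c₀)`.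
[cite: Kubota1965, §2] [cite: Shimura1998, §8.2 Prop. 26] -/
theorem exists_liftTwo_certificate (hfσ : ∀ q, f (σ q) = q) {n₁ : G} (hn₁ : f n₁ = 1) (h₁ : n₁ ≠ 1)
    (hker : ∀ n : G, f n = 1 → n = 1 ∨ n = n₁) (hexp : ∃ g : Q, g * g ≠ 1) (c₀ : Q) (T₀ : Finset Q)
    (hcm : ∀ q : Q, q ∈ T₀ ↔ c₀ * q ∉ T₀) (hprim : ∀ v : Q, v ≠ 1 → ∃ w : Q, ¬ (w ∈ T₀ ↔ v * w ∈ T₀)) (b₀ : Q → ℤ)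
    (hanti : ∀ q, b₀ (c₀ * q) = -b₀ q) (hann : ∀ g : Q, ∑ s ∈ T₀, b₀ (s * g) = 0) (hb : ∃ q, b₀ q ≠ 0) :
    ∃ (S : Finset G) (b : G → ℤ), (∀ x : G, x ∈ S ↔ σ c₀ * x ∉ S) ∧
      (∀ v : G, v ≠ 1 → ∃ w : G, ¬ (w ∈ S ↔ v * w ∈ S)) ∧ (∀ x, b (σ c₀ * x) = -b x) ∧
      (∀ g : G, ∑ s ∈ S, b (s * g) = 0) ∧ ∃ x, b x ≠ 0 := by
  obtain ⟨w, hw⟩ := exists_forall_involution_translate_ne T₀ hprim hexp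
  exact ⟨Finset.univ.filter fun y : G => if (σ (f y))⁻¹ * y = 1 then f y ∈ T₀ else f y * w⁻¹ ∈ T₀,
    fun x => if σ (f x) = x then b₀ (f x) else 0,
    mem_liftTwo_cm hfσ c₀ T₀ hcm w, liftTwo_leftStabiliser hfσ hn₁ h₁ hker T₀ hprim w hw,
    liftWeight_antisymm hfσ c₀ b₀ hanti, liftTwo_annihilated hfσ T₀ b₀ hann w, liftWeight_ne_zero hfσ b₀ hb⟩

end ModelTwo

end SplitExtension

/-! ## §3 The theorems for Galois CM fields -/

section Field

variable {K : Type} [Field K] [NumberField K] [IsCMField K] [IsGalois ℚ K]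

/-- **Split extension with kernel of order two over a certified-BAD quotient not of exponent two ⟹ BAD.**  `e : Gal(K/ℚ) ≃* G₀`,
`f ∘ σ = id` on `G₀ ⇄ Q₀`, `ker f = {1, n₁}`, `Q₀` not of exponent `2`, complex conjugation `σ(c₀)`, an annihilator certificate
for `(Q₀, c₀)` ⟹ `K` carries a SIMPLE DEGENERATE abelian variety of dimension `|G₀|/2` with CM by `K` (a rational `(p,p)`
class outside the divisor ring on some power). [cite: Kubota1965, §2 and §4 Lemma 2] [cite: Shimura1998, §6.2 Thm. 3 and §8.2 Prop. 26]
[cite: Gordon1999HodgeAVSurvey, Thm. 6.4 and §9.3] -/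
theorem exists_simple_degenerate_of_split_two_certificate {G₀ Q₀ : Type*} [Group G₀] [Fintype G₀] [DecidableEq G₀]
    [Group Q₀] [Fintype Q₀] [DecidableEq Q₀] (e : (K ≃ₐ[ℚ] K) ≃* G₀) (f : G₀ →* Q₀) (σ : Q₀ →* G₀)
    (hfσ : ∀ q, f (σ q) = q) {n₁ : G₀} (hn₁ : f n₁ = 1) (h₁ : n₁ ≠ 1) (hker : ∀ n : G₀, f n = 1 → n = 1 ∨ n = n₁)
    (hexp : ∃ g : Q₀, g * g ≠ 1) (c₀ : Q₀) (hc : e ((IsCMField.complexConj K).restrictScalars ℚ) = σ c₀)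
    (T₀ : Finset Q₀) (hcm : ∀ q : Q₀, q ∈ T₀ ↔ c₀ * q ∉ T₀)
    (hprim : ∀ v : Q₀, v ≠ 1 → ∃ w : Q₀, ¬ (w ∈ T₀ ↔ v * w ∈ T₀)) (b₀ : Q₀ → ℤ) (hanti : ∀ q, b₀ (c₀ * q) = -b₀ q)
    (hann : ∀ g : Q₀, ∑ s ∈ T₀, b₀ (s * g) = 0) (hb : ∃ q, b₀ q ≠ 0) :
    ∃ (Φ : CMType K) (φ₀ : K →+* ℂ) (X : AbelianVariety ℂ) (ι : 𝓞 K →+* End X)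
      (ϑ : K →+* Module.End ℂ (complexBetti X.X 1)),
      IsPrimitive (ℂ ≃+* ℂ) Φ.1 φ₀ ∧ ¬ IsNondegenerate Φ ∧ IsCMTypeRealisation Φ X ι ϑ ∧ X.IsSimple ∧
      X.dim = Fintype.card G₀ / 2 ∧
      ∃ m p : ℕ, ∃ y : complexBetti (⨁ fun _ : Fin m => X).X (2 * p), IsRationalClass y ∧
        IsOfHodgeType (⨁ fun _ : Fin m => X).dim (⨁ fun _ : Fin m => X).X (2 * p) p p y ∧
        y ∉ divisorClassesSpan (⨁ fun _ : Fin m => X).X (⨁ fun _ : Fin m => X).dim p := by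
  obtain ⟨S, b, hcm', hprim', hanti', hann', hb'⟩ :=
    SplitExtension.exists_liftTwo_certificate hfσ hn₁ h₁ hker hexp c₀ T₀ hcm hprim b₀ hanti hann hb
  exact exists_simple_degenerate_of_model_annihilator e (σ c₀) hc S hcm' hprim' b hanti' hann' hb'

/-- **`Γ₀ × C₂` IS BAD FOR EVERY CERTIFIED-BAD `Γ₀` NOT OF EXPONENT TWO** (and, with `CorCM/GaloisCertificateSplitExtension`,
`Γ₀ × H` for every finite group `H ≠ 1`): `e : Gal(K/ℚ) ≃* Γ₀ × H` with `|H| = 2`, complex conjugation `(c₀, 1)`, some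
`g ∈ Γ₀` with `g² ≠ 1`, and an annihilator certificate for `(Γ₀, c₀)` ⟹ `K` carries a simple degenerate abelian variety of
dimension `|Γ₀|·|H|/2 = |Γ₀|` with CM by `K`. [cite: Kubota1965, §2 and §4 Lemma 2] [cite: Shimura1998, §6.2 Thm. 3 and §8.2 Prop. 26]
[cite: Gordon1999HodgeAVSurvey, Thm. 6.4 and §9.3] -/
theorem exists_simple_degenerate_prod_of_certificate_of_sq_ne_one {Γ₀ H : Type*} [Group Γ₀] [Fintype Γ₀] [DecidableEq Γ₀]
    [Group H] [Fintype H] [DecidableEq H] (hH : Fintype.card H = 2) (hexp : ∃ g : Γ₀, g * g ≠ 1)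
    (e : (K ≃ₐ[ℚ] K) ≃* Γ₀ × H) (c₀ : Γ₀) (hc : e ((IsCMField.complexConj K).restrictScalars ℚ) = (c₀, 1)) (T₀ : Finset Γ₀)
    (hcm : ∀ x : Γ₀, x ∈ T₀ ↔ c₀ * x ∉ T₀) (hprim : ∀ v : Γ₀, v ≠ 1 → ∃ w : Γ₀, ¬ (w ∈ T₀ ↔ v * w ∈ T₀))
    (b : Γ₀ → ℤ) (hanti : ∀ y, b (c₀ * y) = -b y) (hann : ∀ g : Γ₀, ∑ s ∈ T₀, b (s * g) = 0) (hb : ∃ y, b y ≠ 0) :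
    ∃ (Φ : CMType K) (φ₀ : K →+* ℂ) (X : AbelianVariety ℂ) (ι : 𝓞 K →+* End X)
      (ϑ : K →+* Module.End ℂ (complexBetti X.X 1)),
      IsPrimitive (ℂ ≃+* ℂ) Φ.1 φ₀ ∧ ¬ IsNondegenerate Φ ∧ IsCMTypeRealisation Φ X ι ϑ ∧ X.IsSimple ∧
      X.dim = Fintype.card Γ₀ ∧
      ∃ m p : ℕ, ∃ y : complexBetti (⨁ fun _ : Fin m => X).X (2 * p), IsRationalClass y ∧
        IsOfHodgeType (⨁ fun _ : Fin m => X).dim (⨁ fun _ : Fin m => X).X (2 * p) p p y ∧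
        y ∉ divisorClassesSpan (⨁ fun _ : Fin m => X).X (⨁ fun _ : Fin m => X).dim p := by
  -- the non-trivial element of `H`
  obtain ⟨h₁, hh₁, huniq⟩ := SplitExtension.exists_ne_one_of_card_eq_two (H := H) (by rw [Nat.card_eq_fintype_card, hH])
  obtain ⟨Φ, φ₀, X, ι, ϑ, H1, H2, H3, H4, H5, H6⟩ :=
    exists_simple_degenerate_of_split_two_certificate e (MonoidHom.fst Γ₀ H) (MonoidHom.inl Γ₀ H) (fun q => rfl)
      (n₁ := (1, h₁)) rfl (fun h => hh₁ (Prod.mk.inj h).2)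
      (fun n hn => by
        rcases huniq n.2 with h | h
        · left; exact Prod.ext hn h
        · right; exact Prod.ext hn h)
      hexp c₀ (by rw [hc]; rfl) T₀ hcm hprim b hanti hann hb
  refine ⟨Φ, φ₀, X, ι, ϑ, H1, H2, H3, H4, ?_, H6⟩
  rw [H5, Fintype.card_prod, hH, Nat.mul_div_cancel _ two_pos]

end Field

end Summit.HodgeConjecture.CorCM.GaloisModels

end
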